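import Summits.Ventures.PercRepro.S1FiveCircuitBase

/-!
# PercRepro — THE KILL COUNT OF THE FIVE-SUBSETS OF AN `8`-SET (p8 g8, S3; finset lemmas for `s₅ ≤ 47`)

In an `8`-element finset: at least `10` of the five-subsets contain a given subset with `≤ 3` elements
(`ten_le_card_filter_subset`; p2's `four_le_card_filter_subset` with `3`), at most one contains a given set of `≥ 5`
elements (`card_filter_subset_le_one`), two such filters meet in the filter of the union (`filter_subset_inter`), and
the Bonferroni bound for three finsets (`card_union_three_ge`). Axioms: standard.
-/

namespace PercRepro

namespace S1

variable {α : Type}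

/-- **The kill count for a small circuit**: in an `8`-element finset, at least `10` of the `5`-subsets contain a given
subset with `≤ 3` elements (`C(8 − k, 5 − k) ≥ 10` for `k ≤ 3`; p2's `four_le_card_filter_subset` with `3`). -/
theorem ten_le_card_filter_subset (Ef Df : Finset α) [DecidableEq α] (hE : Ef.card = 8) (hDE : Df ⊆ Ef)
    (hD : Df.card ≤ 3) :
    10 ≤ ((Ef.powersetCard 5).filter (fun S => Df ⊆ S)).card := by
  have hmaps : Set.MapsTo (fun T => Df ∪ T) ((Ef \ Df).powersetCard (5 - Df.card))
      ((Ef.powersetCard 5).filter (fun S => Df ⊆ S)) := by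
    intro T hT
    rw [Finset.mem_coe, Finset.mem_powersetCard] at hT
    rw [Finset.mem_coe, Finset.mem_filter, Finset.mem_powersetCard]
    refine ⟨⟨Finset.union_subset hDE (hT.1.trans Finset.sdiff_subset), ?_⟩, Finset.subset_union_left⟩
    rw [Finset.card_union_of_disjoint (Finset.disjoint_of_subset_right hT.1 Finset.disjoint_sdiff), hT.2]
    omega
  have hinj : Set.InjOn (fun T => Df ∪ T) ((Ef \ Df).powersetCard (5 - Df.card)) := by
    intro T₁ hT₁ T₂ hT₂ h
    rw [Finset.mem_coe, Finset.mem_powersetCard] at hT₁ hT₂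
    have e₁ : (Df ∪ T₁) \ Df = T₁ := Finset.union_sdiff_cancel_left (Finset.disjoint_of_subset_right hT₁.1 Finset.disjoint_sdiff)
    have e₂ : (Df ∪ T₂) \ Df = T₂ := Finset.union_sdiff_cancel_left (Finset.disjoint_of_subset_right hT₂.1 Finset.disjoint_sdiff)
    simp only at h
    rw [← e₁, ← e₂, h]
  have hle := Finset.card_le_card_of_injOn _ hmaps hinj
  rw [Finset.card_powersetCard, Finset.card_sdiff_of_subset hDE, hE] at hle
  have hchoose : 10 ≤ (8 - Df.card).choose (5 - Df.card) := by
    have : Df.card ≤ 3 := hD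
    interval_cases Df.card <;> decide
  omega

/-- At most one `5`-subset contains a set of `≥ 5` elements. -/
theorem card_filter_subset_le_one (Ef U : Finset α) [DecidableEq α] (hU : 5 ≤ U.card) :
    ((Ef.powersetCard 5).filter (fun S => U ⊆ S)).card ≤ 1 := by
  have hsub : (Ef.powersetCard 5).filter (fun S => U ⊆ S) ⊆ {U} := by
    intro S hS
    rw [Finset.mem_filter, Finset.mem_powersetCard] at hS
    rw [Finset.mem_singleton]
    exact (Finset.eq_of_subset_of_card_le hS.2 (by omega)).symm
  exact (Finset.card_le_card hsub).trans (by simp)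

/-- Two filters `{S ⊇ C₁}`, `{S ⊇ C₂}` of the `5`-subsets meet in `{S ⊇ C₁ ∪ C₂}`. -/
theorem filter_subset_inter (Ef C₁ C₂ : Finset α) [DecidableEq α] :
    (Ef.powersetCard 5).filter (fun S => C₁ ⊆ S) ∩ (Ef.powersetCard 5).filter (fun S => C₂ ⊆ S) =
      (Ef.powersetCard 5).filter (fun S => C₁ ∪ C₂ ⊆ S) := by
  ext S
  simp only [Finset.mem_inter, Finset.mem_filter, Finset.union_subset_iff]
  tauto

/-- **Bonferroni for three killers**: `|K₁ ∪ K₂ ∪ K₃| ≥ |K₁| + |K₂| + |K₃| − |K₁ ∩ K₂| − |K₁ ∩ K₃| − |K₂ ∩ K₃|`. -/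
theorem card_union_three_ge (K₁ K₂ K₃ : Finset (Finset α)) [DecidableEq α] :
    K₁.card + K₂.card + K₃.card ≤ (K₁ ∪ K₂ ∪ K₃).card + (K₁ ∩ K₂).card + (K₁ ∩ K₃).card + (K₂ ∩ K₃).card := by
  have h1 := Finset.card_union_add_card_inter K₁ K₂
  have h2 := Finset.card_union_add_card_inter (K₁ ∪ K₂) K₃
  have h3 : ((K₁ ∪ K₂) ∩ K₃).card ≤ (K₁ ∩ K₃).card + (K₂ ∩ K₃).card := by
    rw [Finset.union_inter_distrib_right]
    exact Finset.card_union_le _ _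
  omega

end S1

end PercRepro
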